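import Summits.BirchSwinnertonDyer.BirchSwinnertonDyer.Theorems.KatoDescentPotSupersingularWildUpperNonsurjNodes
import Summits.BirchSwinnertonDyer.BirchSwinnertonDyer.Theorems.KatoDescentPotSupersingularReducibleUpperOfCountInputsNodes
import Summits.BirchSwinnertonDyer.BirchSwinnertonDyer.Theorems.KatoDescentPotSupersingularWildFineSelmerOrdinaryUnitAnchor
import HarnessLib

/-!
# Route `KatoDescentPotSupersingular` (rung K9, cell `bsd-potss`): the U₀ BILL of item
# stmt-BirchSwinnertonDyer-19197 `WildUpperDefectRankZero` AFTER kmc Part 16 and the unit-anchor link —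
# the body of the item from cite-level inputs + L₀ + R₁ + ONE anchor certificate per ♯ row, with NO
# reducible residue (a `--supports … --as helper` file; seat `bsd-potss-k9-c4` g4; ROUTE-FREE; nothing
# booked, BSD is not proved by any of this, the item is NOT closed)

What changed since the g3 bill (`…WildUpperDefectBill.lean`, p447640: cites + L₀ + R₁ + M + `hT` + `hcert`):
* the REDUCIBLE rows need no residue any more: kmc g9's Part 16 (`ReducibleUpperOfCountInputs.
  missingUpperBoundAt_of_memberCountInputs`, p450845) gives the upper half on EVERY reducible additive
  potentially-good rank-`0` row from ONE cite-level input (`Kato2004.exists_memberHullCountInputs`, the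
  sharp rank-`0` count at Kato's member, reviewed p448371) + `nonempty_iwasawaH1Data` + modularity +
  Cassels/GZK — so `hM` and `hT` disappear;
* the ♯-row certificate gains a third, CHECKABLE currency: a congruent GOOD-ORDINARY UNIT ANCHOR
  (`WildFineSelmerOrdinaryUnitAnchor.finite_selmerInfty_pTorsion_of_unitData`, this seat g4, below the
  named fact `Schneider1985_order_charGenerator_odd`): `W′` globally minimal with `W′[3] ≃ W[3]`, good
  ordinary at `3`, `rank E′(ℚ) = 0`, `#Ш(E′)[3^∞] = 1`, `3 ∤ #E′(ℚ)_tors · ∏ c_ℓ(E′) · #Ẽ′(𝔽₃)`.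

So: **BODY of `WildUpperDefectRankZero` ⟸ {Heegner cites, A161″ + GZK + modularity, fine-Selmer Kato
p420034 + Burungale–Flach, Cassels, Lim–Sujatha p445851, Perrin-Riou–Schneider, Kato's 𝐇¹ data +
member count inputs} + L₀ (rationality) + R₁ (the declared residual) + per irreducible tower-deficient ♯
non-CM row ONE congruent anchor carrying (A) ∨ finite `Sel_{3^∞}(W′/ℚ^cyc)[3]` ∨ unit data.**
The ♯ rows' anchors are the only non-cite, non-route input left (census: k8t-c4 g4 / conjA-anchor seat).
Composition of landed kernel theorems only; conditional (audit `proof.conditional`).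

References: [Kato2004Asterisque] Thm. 14.5 (3), Prop. 14.16 (2), (14.9.3); [GreenbergLNM1716] Thm. 4.1;
[BalakrishnanMullerStein2015] Thm. 1.7; [LimSujatha2018] §3 Prop. 3.2; [MatarNekovar2019] Thm. 0.3;
[GrossZagier1986]; [KolyvaginEulerSystems1990]; [BumpFriedbergHoffstein1990]; [CoatesSujatha2005] §3.
-/

set_option autoImplicit false
-- sibling precedent (`KatoDescentPotSupersingularAssembly.lean`): the directory name repeats the summit name
set_option linter.dupNamespace false

noncomputable section

open scoped Classical

namespace Summit.BirchSwinnertonDyer.BirchSwinnertonDyer.Theorems.WildUpperDefectBillCount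

open WeierstrassCurve Literature.NumberTheory.EllipticCurves
  Literature.NumberTheory.EllipticCurves.ModularForms
  Literature.NumberTheory.EllipticCurves.Rank1Residual
  Literature.NumberTheory.EllipticCurves.Rank1Residual.Typed
  Summit.BirchSwinnertonDyer.Rank1Residual Summit.BirchSwinnertonDyer.Rank1Residual.Additive
  Summit.BirchSwinnertonDyer.Rank1Residual.O6
  Summit.BirchSwinnertonDyer.BirchSwinnertonDyer.Theorems

/-- **THE U₀ BILL (item 19197) after kmc Part 16 and k9-c4 g4.** Granted the published inputs — Heegner
cites (`hGZ`, `hKo`, `hMN`, `hnf`, `hBFH`), A161″ + GZK + modularity (`hK`), fine-Selmer Kato p420034 +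
Burungale–Flach (`hF`), Cassels (`hCassels`), Lim–Sujatha (`hLS`), Perrin-Riou–Schneider (`hPRS`), Kato's
`𝐇¹` data (`hne`) and the member count inputs (`hin`) —, the route's crux L₀ (`h₂`, rationality only),
the residual R₁ (`hR`), and ONE certificate per irreducible, tower-deficient, ♯ (`3 ∣ ∏c_ℓ` or no
Manin-clean datum), non-CM row: a curve `W′/ℚ` (globally minimal model) with `W′[3] ≃ W[3]` carrying
(A) at `(W′,3)`, OR finite `Sel_{3^∞}(W′/ℚ^cyc)[3]` for every cyclotomic datum, OR Greenberg unit data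
(good ordinary at `3`, `rank E′(ℚ) = 0`, `#Ш(E′)[3^∞] = 1`, `3 ∤ #tors · Tam · #Ẽ′(𝔽₃)`): the BODY of
`WildUpperDefectRankZero` holds verbatim — no reducible residue, no parity input. Conditional; the item is
NOT closed. [cite: Kato2004Asterisque, Thm. 14.5 (3) (p. 236), Prop. 14.16 (2) (p. 244)]
[cite: GreenbergLNM1716, §4 Thm. 4.1 (p. 85)] [cite: LimSujatha2018, §3 Prop. 3.2]
[cite: MatarNekovar2019, Thm. 0.3 (p. 456)] -/
theorem wildUpperDefectRankZero_bill_of_countInputs_of_anchors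
    (hGZ : ∀ (N : ℕ) [NeZero N] (W : WeierstrassCurve ℚ) (K : Type) [Field K] [NumberField K],
      gross_zagier N W K)
    (hKo : ∀ (N : ℕ) [NeZero N] (W : WeierstrassCurve ℚ) (K : Type) [Field K] [NumberField K],
      kolyvagin N W K)
    (hMN : ∀ (N : ℕ) [NeZero N] (W : WeierstrassCurve ℚ) (K : Type) [Field K] [NumberField K],
      MatarNekovar2019.thm03_padicValNat_card_sha_le_of_irreducible N W K)
    (hnf : exists_isNewformOf) (hBFH : bumpFriedbergHoffstein_exists_heegnerField_split_twist_simpleZero)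
    (hK : Kato2004.rankZero_padicValNat_sha_add_padicValNat_tamagawa_le_of_additive_potGood_of_imageContainsSL2 ∧
      rank_eq_analyticRank_of_analyticRank_le_one ∧ WeierstrassCurve.hasEntireLFunction_rat)
    (hF : Kato2004.rankZero_padicValNat_sha_add_padicValNat_tamagawa_le_of_additive_potGood_of_irreducible_of_fineSelmerDual_fg ∧
      bsdTriple_of_hasCM_of_L_one_ne_zero)
    (hCassels : bsdRHS_eq_of_isIsogenous)
    (hLS : LimSujatha2018.prop32_fineSelmerDual_moduleFinite_iff_of_torsionIso)
    (hPRS : Schneider1985_order_charGenerator_odd)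
    (hne : Kato2004.nonempty_iwasawaH1Data) (hin : Kato2004.exists_memberHullCountInputs)
    (h₂ : ∀ (W : WeierstrassCurve ℚ) [W.IsElliptic] [W.IsGloballyMinimal] [Fact (3 : ℕ).Prime],
      W.analyticRank = 0 → ClassO6 W 3 → MissingLowerBoundAt W 3)
    (hR : ∀ (W : WeierstrassCurve ℚ) [W.IsElliptic] [W.IsGloballyMinimal] [Fact (3 : ℕ).Prime],
      W.analyticRank = 1 → ClassO6 W 3 → MissingPPartAt W 3)
    (hcert : ∀ (W : WeierstrassCurve ℚ) [W.IsElliptic] [W.IsGloballyMinimal] [Fact (3 : ℕ).Prime],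
      W.analyticRank = 0 → ClassO6 W 3 → W.HasIrreducibleModPGaloisRep 3 →
      ¬ (∀ n : ℕ, W.HasSurjectiveModNGaloisRep (3 ^ n : ℕ)) →
      (3 ∣ W.tamagawaProduct ∨ ∀ [NeZero (W.conductorNorm ℤ)]
        (D : ModularParametrizationData W (W.conductorNorm ℤ)), (3 : ℤ) ∣ D.maninConstant) →
      ¬ W.HasCM →
      ∃ (W' : WeierstrassCurve ℚ) (_ : W'.IsElliptic) (_ : W'.IsGloballyMinimal), ModPCongruent W' W 3 ∧
        ((∀ (κ : ZpExtension ℚ 3), κ.IsCyclotomic →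
            ∃ (γ : Field.absoluteGaloisGroup ℚ) (D : W'.FineSelmerDualData κ γ),
              Module.Finite ℤ_[3] (RestrictScalars ℤ_[3] (IwasawaAlgebra 3) D.X)) ∨
          (∀ (κ : ZpExtension ℚ 3), κ.IsCyclotomic → Set.Finite {s : W'.selmerInfty κ | 3 • s = 0}) ∨
          (W'.HasGoodReductionAtPrime 3 ∧ ¬ (3 : ℤ) ∣ W'.frobeniusTrace 3 ∧ W'.mordellWeilRank = 0 ∧
            Nat.card (AddCommGroup.primaryComponent W'.sha 3) = 1 ∧ ¬ 3 ∣ W'.torsionOrder ∧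
            ¬ 3 ∣ W'.tamagawaProduct ∧ ¬ 3 ∣ W'.reductionPointCount 3))) :
    ∀ (W : WeierstrassCurve ℚ) [W.IsElliptic] [W.IsGloballyMinimal] [Fact (3 : ℕ).Prime],
      W.analyticRank = 0 → ClassO6 W 3 →
      ¬ (((∀ n : ℕ, W.HasSurjectiveModNGaloisRep (3 ^ n : ℕ)) ∧ ¬ 3 ∣ W.tamagawaProduct ∧
            ∃ (N : ℕ) (_ : NeZero N) (D : ModularParametrizationData W N), ¬ (3 : ℤ) ∣ D.maninConstant) ∨
        (¬ W.HasIrreducibleModPGaloisRep 3 ∧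
          (∀ (W' : WeierstrassCurve ℚ) [W'.IsElliptic], IsIsogenous W W' → ¬ 3 ^ 2 ∣ W'.torsionOrder) ∧
          ∀ q : ℚ, shaAn W = (q : ℂ) → Even (padicValRat 3 q))) →
      MissingUpperBoundAt W 3 := by
  -- (A) on the ♯ non-CM irreducible tower-deficient rows, from the per-row anchors (three currencies)
  have hCSsharp : ∀ (W : WeierstrassCurve ℚ) [W.IsElliptic] [W.IsGloballyMinimal] [Fact (3 : ℕ).Prime],
      W.analyticRank = 0 → ClassO6 W 3 → W.HasIrreducibleModPGaloisRep 3 →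
      ¬ (∀ n : ℕ, W.HasSurjectiveModNGaloisRep (3 ^ n : ℕ)) →
      (3 ∣ W.tamagawaProduct ∨ ∀ [NeZero (W.conductorNorm ℤ)]
        (D : ModularParametrizationData W (W.conductorNorm ℤ)), (3 : ℤ) ∣ D.maninConstant) →
      ¬ W.HasCM → ∀ (κ : ZpExtension ℚ 3), κ.IsCyclotomic →
        ∃ (γ : Field.absoluteGaloisGroup ℚ) (Df : W.FineSelmerDualData κ γ),
          Module.Finite ℤ_[3] (RestrictScalars ℤ_[3] (IwasawaAlgebra 3) Df.X) := by
    intro W _ _ _ hr hO hirr hns hsharp hcm κ hκ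
    obtain ⟨W', hW', hW'min, hcong, hA' | hfin' | hunit'⟩ := hcert W hr hO hirr hns hsharp hcm
    · haveI := hW'
      exact WildFineSelmerCongruenceFact.conjA_of_modPCongruent hLS (by norm_num) hcong hA' κ hκ
    · haveI := hW'
      exact WildFineSelmerCongruenceFact.conjA_of_modPCongruent hLS (by norm_num) hcong
        (WildFineSelmerOrdinaryAnchor.conjA_rat_of_finite_selmerInfty_pTorsion W' hfin') κ hκ
    · haveI := hW'
      haveI := hW'min
      obtain ⟨hgood', hord', hrank', hsha', htors', htam', hNp'⟩ := hunit'
      exact WildFineSelmerCongruenceFact.conjA_of_modPCongruent hLS (by norm_num) hcong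
        (WildFineSelmerOrdinaryAnchor.conjA_rat_of_finite_selmerInfty_pTorsion W' fun κ' hκ' ↦
          WildFineSelmerOrdinaryUnitAnchor.finite_selmerInfty_pTorsion_of_unitData hPRS W' (by decide)
            hgood' hord' hrank' hsha' htors' htam' hNp' κ' hκ') κ hκ
  intro W _ _ _ hr hO hncov
  by_cases hirr : W.HasIrreducibleModPGaloisRep 3
  · by_cases hsurj : ∀ n : ℕ, W.HasSurjectiveModNGaloisRep (3 ^ n : ℕ)
    · -- irreducible, tower onto: A161″ (Tamagawa-exact, Manin-free)
      exact X4RankZero.missingUpperBoundAt_of_katoTam (W := W) (p := 3) hK.1 hK.2.1 hK.2.2 hr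
        ⟨hO.1, hO.2.1, hirr⟩ hO.padicValRat_j_nonneg hsurj
    · -- irreducible, tower not onto: the Heegner road + (A) on the ♯ rows from the anchors
      exact WildUpperHeegnerRoad.wildUpperNonsurjTower_of_lower_of_rankOne_of_fineSelmerSharp hGZ hKo hMN hnf
        hBFH hK hF h₂ hR hCSsharp W hr hO hirr hsurj
  · -- reducible: the sharp count at Kato's member (kmc Part 16), every reducible row, no residue
    exact ReducibleUpperOfCountInputs.missingUpperBoundAt_of_memberCountInputs hne hnf hin hCassels hK.2.1
      hK.2.2 W 3 hO.1 hO.2.1.1 hO.2.1.2 hO.padicValRat_j_nonneg hirr hr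

end Summit.BirchSwinnertonDyer.BirchSwinnertonDyer.Theorems.WildUpperDefectBillCount

end
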